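import Summits.ABC.IUTFork.Joshi.TestVolumeDictionaryGenuine
import HarnessLib

/-!
# TEST (R-J row Y-08), sequel: the one-prime [J-IIp] inputs at EVERY REAL spec `log|ξ|_0 = c < 0` (norm exponent `s`), and
# `VolumeDictionary ⟺ hull-sum = 0` wherever the q-contribution is a label-constant negative number (kernel; located)

Test-side file of the abc-iut cell, block E / rescue sub-cell R-J «Joshi Y-discharge census» (rung LADDER-ABC:A2.RESCUE.J; seat
abc-iut-E-t57, gen 5; row Y-08 `Joshi.VolumeDictionary` of `plan/E/R-J/Y-CENSUS.tsv`, E-plan ruling 2026-08-26T14:00:15Z). Sequel of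
this seat's `Joshi/TestVolumeDictionaryGenuine.lean` (p451059: `Model.prototypeDatumOf p n ξ` over abc-iut-E-t3's `Model.periodRingDatum p`
— `|ξ|_0` ranges over the norms `p^{−r}`, `r ∈ ℚ_{>0}`, of `Q̄_p`; `exists_volumeDictionary_iff_hullSum_eq_zero` therefore asks the
q-contribution to be `−r·log p` with `r` RATIONAL). At the certificate setting `Thm311.Real.settingPrVolSharp` the q-pilot packet
contribution at a prime `p` under `Supp(𝔮)` is a label-constant NEGATIVE REAL for EVERY q-idele family (abc-iut-E-t4 lineage
`qLocal_settingPrVolSharp_inr_labelIndep`, abc-iut-c312-7 `qLocal_settingPrVolSharp_neg_iff`); its rationality in units of `log p` holds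
under the realising hypotheses but is beside the point. This file removes the arithmetic side condition: E-t3's model period-ring
signature is re-instantiated with ALL absolute values raised to a real power `s > 0` (`Model.periodRingDatumPow p s`; axioms (A1)–(A4)
are multiplicative identities, preserved), so that with `ξ := p` one has `log|ξ|_0 = −s·log p` — EVERY negative real. Source on the
Joshi side: K. Joshi, arXiv:2303.01662 v3 = [J-IIp] (`paper:arxiv-2303.01662`, bib `Joshi2023ATS2Local`; Def. 8.3.1 p. 24 l. 9–19,
§8.7 p. 25 l. 28 – p. 26 l. 2, Thm. 9.2.1 p. 27 l. 3–6, §9.3 p. 29 l. 7–40), UNREFEREED, rejected by the IUT author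
[Mochizuki2024JoshiReport], accepted by neither side of the dispute (D-0012). FRAMING: locates / conditionally verifies; no abc claim;
no side taken on [IUTchIII] Cor. 3.12 or on any author; typed ≠ proved ≠ endorsed; a model exhibits SATISFIABILITY of typed
hypotheses, nothing more. `S := Cor312Vol.PilotKummerIndRelated` occurs nowhere below.

## What is shown (kernel)

1. `Model.periodRingDatumPow p s` / `Model.prototypeDatumPow p n s` (`ℓ⋆ := n + 1`, `ξ := p`, `q_E := p^{2ℓ}`, every absolute value
   and norm `:= ‖·‖^s`), with canonical point, root tower, `|Θ̃|_B = 1` and **`log|ξ|_0 = −s·log p`**; hence the one-prime inputs of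
   Thm. 9.2.1 at EVERY real spec `(ℓ⋆, c)`, `c < 0` (`Model.thm921_inputs_at_real_spec`).
2. **Row Y-08 at an arbitrary setting `P` and place `v_ℚ₀`, real form**: if the q-pilot packet contribution at `v_ℚ₀` is the SAME
   NEGATIVE REAL `c` at every label of `𝔽_l^⋇`, then some norm exponent `s` gives a volume dictionary from the model datum iff
   `Σ_j μ^log(ⁿ˒°𝒰_{j,v_ℚ₀}) = 0` (`exists_volumeDictionary_iff_hullSum_eq_zero_real`); together with p451059's necessity halves (EVERY
   datum: `qLocal ≡ log|ξ|_0 < 0`; every datum with root tower and `|Θ̃|_B ≤ 1`: hull-sum `= 0`) this DECIDES Y_vol on OUR side at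
   such a place as the coincidence «hull-sum `= 0`» — packaged `volumeDictionary_decided_at_labelConstant_place`.
Reading (neutral): nothing here is derived from, or refutes, a printed statement; the instance at `Thm311.Real.settingPrVolSharp`
follows in the next file. [claim: Joshi2023ATS2Local, status: disputed]
-/

noncomputable section

open Set

namespace Summit.ABC.IUTFork.Joshi

open Thm311 Cor312 Cor312Vol Literature.IUT.LogThetaLattice

/-! ## 1. The period-ring model with norm exponent `s` -/

namespace Model

open PadicAlgCl

variable (p : ℕ) [hp : Fact p.Prime]

/-- Local copy: `‖p‖ = p⁻¹` in `Q̄_p`. [folklore] -/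
private theorem norm_p_pow' : ‖(p : PadicAlgCl p)‖ = (p : ℝ)⁻¹ := by
  rw [← map_natCast (algebraMap ℚ_[p] (PadicAlgCl p)), ← PadicAlgCl.coe_eq]
  show ‖((p : ℚ_[p]) : PadicAlgCl p)‖ = _
  rw [PadicAlgCl.norm_extends, Padic.norm_p]

/-- Local copy: `0 < ‖p‖ < 1`. [folklore] -/
private theorem norm_p_pos_lt_one_pow' : 0 < ‖(p : PadicAlgCl p)‖ ∧ ‖(p : PadicAlgCl p)‖ < 1 := by
  have h1 : (1 : ℝ) < p := by exact_mod_cast hp.out.one_lt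
  rw [norm_p_pow']
  exact ⟨inv_pos.2 (lt_trans one_pos h1), inv_lt_one_of_one_lt₀ h1⟩

/-- `max` commutes with `x ↦ x^s` on `[0, ∞)` (`s ≥ 0`). [folklore] -/
private theorem max_rpow_eq {x y s : ℝ} (hx : 0 ≤ x) (hy : 0 ≤ y) (hs : 0 ≤ s) :
    (max x y) ^ s = max (x ^ s) (y ^ s) := by
  rcases le_total x y with h | h
  · rw [max_eq_right h, max_eq_right (Real.rpow_le_rpow hx h hs)]
  · rw [max_eq_left h, max_eq_left (Real.rpow_le_rpow hy h hs)]

variable (s : ℝ) (hs : 0 < s)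

/-- **The model period-ring datum over `Q̄_p` with norm exponent `s > 0`**: abc-iut-E-t3's `Model.periodRingDatum p` (p432971) with
EVERY absolute value and norm replaced by its `s`-th power (`|−|_F = |−|_0 := ‖·‖^s`, `|b|_ρ := ‖b(p)‖^s`, `|−|_{K_a} := ‖·‖^{e_a·s}`);
Teichmüller/untilt maps, points, Frobenius and scaling exponents unchanged. The axioms are multiplicative identities and survive the
power. DATA of a model. [folklore] -/
def periodRingDatumPow : PeriodRingDatum (PadicAlgCl p) (PadicAlgCl p → PadicAlgCl p) (PadicAlgCl p) (PadicAlgCl p)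
    (fun _ => PadicAlgCl p) Unit where
  p := p
  p_prime := hp.out
  absF := absPow p s hs
  norm _ f := ‖f (p : PadicAlgCl p)‖ ^ s
  norm_nonneg _ f := Real.rpow_nonneg (norm_nonneg _) _
  norm_add_le _ f g := by
    show ‖f (p : PadicAlgCl p) + g (p : PadicAlgCl p)‖ ^ s ≤ max (‖f (p : PadicAlgCl p)‖ ^ s) (‖g (p : PadicAlgCl p)‖ ^ s)
    rw [← max_rpow_eq (norm_nonneg _) (norm_nonneg _) hs.le]
    exact Real.rpow_le_rpow (norm_nonneg _) (PadicAlgCl.isNonarchimedean p _ _) hs.le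
  teich x := fun a => lift p a x
  norm_teich ρ x _ _ := by
    show ‖lift p (p : PadicAlgCl p) x‖ ^ s = absPow p s hs x
    rw [absPow_apply, norm_lift, expo_p, div_one, Real.rpow_one]
  gal _ := id
  frob := id
  gal_norm_one _ _ h := h
  frob_norm_one _ h := h
  absK a := absPow p (expo p a * s) (mul_pos (expo_pos p a) hs)
  eta a := Pi.evalRingHom (fun _ : PadicAlgCl p => PadicAlgCl p) a
  absK_eta_teich a x := by
    show ‖lift p a x‖ ^ (expo p a * s) = ‖x‖ ^ s
    rw [Real.rpow_mul (norm_nonneg _), norm_lift_rpow]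
  exists_teich_lift a ξ _ := lift_surjective p a ξ
  T _ := {0}
  zero_mem_T _ := rfl
  eta_T a τ hτ := by rw [Set.mem_singleton_iff.1 hτ]; rfl
  T_norm_one a τ hτ := by
    rw [Set.mem_singleton_iff.1 hτ]
    show ‖(0 : PadicAlgCl p → PadicAlgCl p) (p : PadicAlgCl p)‖ ^ s ≤ 1
    rw [Pi.zero_apply, norm_zero, Real.zero_rpow hs.ne']
    exact zero_le_one
  pt := id
  frobY y := y ^ p
  pt_frob _ := rfl
  galF _ := RingHom.id _
  absF_galF _ _ := rfl
  galY _ := id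
  pt_gal _ _ := rfl
  abs0 := absPow p s hs
  abs0_p := by
    rw [absPow_apply]
    exact ⟨Real.rpow_pos_of_pos (norm_p_pos_lt_one_pow' p).1 _,
      Real.rpow_lt_one (norm_nonneg _) (norm_p_pos_lt_one_pow' p).2 hs⟩
  emb _ := RingHom.id _
  scale a := expo p a
  scale_pos a := expo_pos p a
  absK_emb a z := by
    show ‖z‖ ^ (expo p a * s) = (‖z‖ ^ s) ^ expo p a
    rw [mul_comm, Real.rpow_mul (norm_nonneg _)]
  absK_pt a ha0 ha1 := by
    show ‖(p : PadicAlgCl p)‖ ^ (expo p a * s) = ‖a‖ ^ s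
    have ha1' : ‖a‖ < 1 := lt_of_not_ge fun h => (not_le.2 ha1) (by rw [absPow_apply]; exact Real.one_le_rpow h hs.le)
    rw [Real.rpow_mul (norm_nonneg _), norm_p_rpow_expo p (norm_pos_iff.2 ha0) ha1']

variable (n : ℕ)

/-- **The [J-IIp] prototype datum at the REAL spec `(ℓ⋆ := n+1, log|ξ|_0 := −s·log p)`**: `ξ := p`, `q_E := p^{2ℓ}` over
`periodRingDatumPow p s`. DATA of a model. [folklore] -/
def prototypeDatumPow :
    PrototypeDatum (PadicAlgCl p) (PadicAlgCl p → PadicAlgCl p) (PadicAlgCl p) (PadicAlgCl p) (fun _ => PadicAlgCl p) Unit where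
  toPeriodRingDatum := periodRingDatumPow p s hs
  lstar := n + 1
  one_le_lstar := Nat.le_add_left 1 n
  q := (p : PadicAlgCl p) ^ (2 * (2 * (n + 1) + 1))
  abs0_q := by
    show 0 < absPow p s hs _ ∧ absPow p s hs _ < 1
    rw [absPow_apply, norm_pow]
    exact ⟨Real.rpow_pos_of_pos (pow_pos (norm_p_pos_lt_one_pow' p).1 _) _,
      Real.rpow_lt_one (pow_nonneg (norm_nonneg _) _)
        (pow_lt_one₀ (norm_nonneg _) (norm_p_pos_lt_one_pow' p).2 (by omega)) hs⟩
  xi := p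
  abs0_xi := by
    show absPow p s hs (p : PadicAlgCl p) =
      (absPow p s hs ((p : PadicAlgCl p) ^ (2 * (2 * (n + 1) + 1)))) ^ (1 / (2 * ((2 * (n + 1) + 1 : ℕ) : ℝ)))
    rw [absPow_apply, absPow_apply, norm_pow]
    have hswap : (‖(p : PadicAlgCl p)‖ ^ (2 * (2 * (n + 1) + 1))) ^ s =
        (‖(p : PadicAlgCl p)‖ ^ s) ^ (2 * (2 * (n + 1) + 1)) := by
      rw [← Real.rpow_natCast, ← Real.rpow_natCast, ← Real.rpow_mul (norm_nonneg _), ← Real.rpow_mul (norm_nonneg _)]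
      congr 1
      ring
    have h : (1 / (2 * ((2 * (n + 1) + 1 : ℕ) : ℝ))) = (((2 * (2 * (n + 1) + 1) : ℕ) : ℝ))⁻¹ := by
      push_cast
      ring
    rw [hswap, h, Real.pow_rpow_inv_natCast (Real.rpow_nonneg (norm_nonneg _) _) (by omega)]

/-- `ℓ⋆ = n + 1`. [folklore] -/
theorem prototypeDatumPow_lstar : (prototypeDatumPow p s hs n).lstar = n + 1 := rfl

/-- **`log|ξ|_0 = −s·log p`** at the real spec. [folklore] -/
theorem log_abs0_xi_pow :
    Real.log ((prototypeDatumPow p s hs n).abs0 (prototypeDatumPow p s hs n).xi) = -(s * Real.log p) := by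
  show Real.log (absPow p s hs (p : PadicAlgCl p)) = _
  rw [absPow_apply, Real.log_rpow (norm_p_pos_lt_one_pow' p).1, log_norm_p]
  ring

/-- The canonical-point datum at the real spec (`t := p`, `a := p^{1/ℓ⋆²}`). [folklore] -/
def canonicalPointPow : (prototypeDatumPow p s hs n).CanonicalPoint where
  t := p
  t_ne_zero := by exact_mod_cast hp.out.ne_zero
  absF_t_lt_one := by
    show absPow p s hs _ < 1
    rw [absPow_apply]
    exact Real.rpow_lt_one (norm_nonneg _) (norm_p_pos_lt_one_pow' p).2 hs
  scale_pt_t := expo_p p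
  a := rootP p ((n + 1) ^ 2)
  a_pow := by show rootP p ((n + 1) ^ 2) ^ ((n + 1) ^ 2) = (p : PadicAlgCl p); exact rootP_pow p (by positivity)

/-- The root tower at the real spec (`t^{1/N} := rootP N`). [folklore] -/
def rootTowerPow : (prototypeDatumPow p s hs n).RootTower where
  t := p
  t_ne_zero := by exact_mod_cast hp.out.ne_zero
  absF_t_lt_one := (canonicalPointPow p s hs n).absF_t_lt_one
  scale_pt_t := expo_p p
  root := rootP p
  root_pow N hN := rootP_pow p hN

/-- `|Θ̃|_B ≤ 1` at the real spec (norms do not read `ρ`; Prop. 9.4.1 as typed). [folklore] -/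
theorem size_thetaLocus_pow_le_one : (prototypeDatumPow p s hs n).size (prototypeDatumPow p s hs n).thetaLocus ≤ 1 :=
  iSup₂_le fun ρ _ => by
    have : (prototypeDatumPow p s hs n).sizeAt (prototypeDatumPow p s hs n).thetaLocus ρ =
        (prototypeDatumPow p s hs n).sizeAt (prototypeDatumPow p s hs n).thetaLocus 1 := rfl
    rw [this]
    exact (prototypeDatumPow p s hs n).sizeAt_one_thetaLocus_le_one

/-- **`|Θ̃|_B = 1`** at the real spec. [claim: Joshi2023ATS2Local, status: disputed] -/
theorem size_thetaLocus_pow_eq_one : (prototypeDatumPow p s hs n).size (prototypeDatumPow p s hs n).thetaLocus = 1 :=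
  le_antisymm (size_thetaLocus_pow_le_one p s hs n) (rootTowerPow p s hs n).one_le_size_thetaLocus

/-- **The one-prime inputs of [J-IIp] Thm. 9.2.1 at every REAL spec**: for every prime `p`, `ℓ⋆ = n + 1` and `c < 0` there is a
prototype datum over `Q̄_p` with `ℓ⋆ = n + 1`, `log|ξ|_0 = c`, canonical point, root tower, Thm. 9.2.1's bound and `|Θ̃|_B = 1`.
[claim: Joshi2023ATS2Local, status: disputed] -/
theorem thm921_inputs_at_real_spec (c : ℝ) (hc : c < 0) :
    ∃ J : PrototypeDatum (PadicAlgCl p) (PadicAlgCl p → PadicAlgCl p) (PadicAlgCl p) (PadicAlgCl p) (fun _ => PadicAlgCl p) Unit,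
      J.lstar = n + 1 ∧ Real.log (J.abs0 J.xi) = c ∧ Nonempty J.CanonicalPoint ∧ Nonempty J.RootTower ∧
        (((J.abs0 J.xi) ^ J.lstar : ℝ) : EReal) ≤ J.size J.thetaLocus ∧ J.size J.thetaLocus = 1 := by
  have hlp : 0 < Real.log p := log_p_pos p
  have hs' : 0 < -c / Real.log p := div_pos (neg_pos.2 hc) hlp
  refine ⟨prototypeDatumPow p _ hs' n, rfl, ?_, ⟨canonicalPointPow p _ hs' n⟩, ⟨rootTowerPow p _ hs' n⟩,
    (prototypeDatumPow p _ hs' n).prototypeBound (canonicalPointPow p _ hs' n), size_thetaLocus_pow_eq_one p _ hs' n⟩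
  rw [log_abs0_xi_pow, div_mul_cancel₀ _ hlp.ne', neg_neg]

end Model

/-! ## 2. `VolumeDictionary ⟺ hull-sum = 0` at every label-constant NEGATIVE REAL q-contribution -/

section RealSpec

variable (p : ℕ) [hp : Fact p.Prime] {T : ThetaIndex} {S : Situation T} (P : Cor312.Setting S) (vQ₀ : T.VQ) (s : ℝ)
  (hs : 0 < s)

/-- The real-spec model datum AT the index of a setting (`ℓ⋆ := T.lstar`). [folklore] -/
def Model.prototypeDatumPowAt (T : ThetaIndex) (s : ℝ) (hs : 0 < s) :
    PrototypeDatum (PadicAlgCl p) (PadicAlgCl p → PadicAlgCl p) (PadicAlgCl p) (PadicAlgCl p) (fun _ => PadicAlgCl p) Unit :=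
  Model.prototypeDatumPow p s hs (T.lstar - 1)

/-- `ℓ⋆` agrees. [folklore] -/
theorem Model.lstar_eq_prototypeDatumPowAt : T.lstar = (Model.prototypeDatumPowAt p T s hs).lstar := by
  show T.lstar = T.lstar - 1 + 1
  have := T.two_le_lstar
  omega

/-- **`VolumeDictionary ⟺ hull-sum = 0` at the real-spec model datum**, whenever the q-pilot packet contribution at `v_ℚ₀` is
`−s·log p` at every label. [claim: Joshi2023ATS2Local, status: disputed] -/
theorem volumeDictionary_prototypeDatumPowAt_iff
    (hq : ∀ i : Fin T.lstar, P.qLocal (Setting.labelSucc i) vQ₀ = -(s * Real.log p)) :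
    VolumeDictionary (Model.prototypeDatumPowAt p T s hs) P vQ₀ ↔
      ∑ i : Fin T.lstar, (S.D P.n).logvol (Setting.labelSucc i) vQ₀ (P.thetaHull (Setting.labelSucc i) vQ₀) = 0 := by
  constructor
  · intro D
    exact hullSum_eq_zero_of_volumeDictionary_of_size_le_one D (Model.rootTowerPow p s hs _)
      (Model.size_thetaLocus_pow_le_one p s hs _)
  · intro hH
    refine ⟨Model.lstar_eq_prototypeDatumPowAt p s hs, fun i => ?_, ?_⟩
    · rw [hq i]
      exact (Model.log_abs0_xi_pow p s hs _).symm
    · rw [hH, Real.exp_zero, EReal.coe_one]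
      exact Model.size_thetaLocus_pow_eq_one p s hs _

/-- **Row Y-08, real form**: if the q-pilot packet contribution at `v_ℚ₀` is the same NEGATIVE REAL `c` at every label of `𝔽_l^⋇`, then
SOME norm exponent `s > 0` gives a volume dictionary from the real-spec model datum iff the hull-sum at `v_ℚ₀` vanishes.
[claim: Joshi2023ATS2Local, status: disputed] -/
theorem exists_volumeDictionary_iff_hullSum_eq_zero_real {c : ℝ} (hc : c < 0)
    (hq : ∀ i : Fin T.lstar, P.qLocal (Setting.labelSucc i) vQ₀ = c) :
    (∃ (s : ℝ) (hs : 0 < s), VolumeDictionary (Model.prototypeDatumPowAt p T s hs) P vQ₀) ↔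
      ∑ i : Fin T.lstar, (S.D P.n).logvol (Setting.labelSucc i) vQ₀ (P.thetaHull (Setting.labelSucc i) vQ₀) = 0 := by
  constructor
  · rintro ⟨s, hs, D⟩
    exact hullSum_eq_zero_of_volumeDictionary_of_size_le_one D (Model.rootTowerPow p s hs _)
      (Model.size_thetaLocus_pow_le_one p s hs _)
  · intro hH
    have hlp : 0 < Real.log p := Model.log_p_pos p
    have hs' : 0 < -c / Real.log p := div_pos (neg_pos.2 hc) hlp
    refine ⟨-c / Real.log p, hs', (volumeDictionary_prototypeDatumPowAt_iff p P vQ₀ _ hs' fun i => ?_).2 hH⟩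
    rw [hq i, div_mul_cancel₀ _ hlp.ne', neg_neg]

/-- **Y-08 DECIDED at a label-constant negative place, packaged** (both directions over the honest class): at a place `v_ℚ₀` where the
q-pilot packet contribution is the same negative real at every label, (a) EVERY prototype datum with a root tower and `|Θ̃|_B ≤ 1`
that admits a volume dictionary forces the hull-sum to vanish, and (b) if the hull-sum vanishes, the real-spec model datum (root tower,
`|Θ̃|_B = 1`) admits one. So Y_vol there ⟺ «`Σ_j μ^log(ⁿ˒°𝒰_{j,v_ℚ₀}) = 0`» on OUR side. [claim: Joshi2023ATS2Local, status: disputed] -/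
theorem volumeDictionary_decided_at_labelConstant_place {c : ℝ} (hc : c < 0)
    (hq : ∀ i : Fin T.lstar, P.qLocal (Setting.labelSucc i) vQ₀ = c) :
    (∀ {F B E0 : Type} [Field F] [CommRing B] [Field E0] {Y : Type} {K : Y → Type} [∀ y, Field (K y)] {G : Type}
        (J : PrototypeDatum F B E0 Y K G), J.RootTower → J.size J.thetaLocus ≤ 1 → VolumeDictionary J P vQ₀ →
          ∑ i : Fin T.lstar, (S.D P.n).logvol (Setting.labelSucc i) vQ₀ (P.thetaHull (Setting.labelSucc i) vQ₀) = 0) ∧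
      (∑ i : Fin T.lstar, (S.D P.n).logvol (Setting.labelSucc i) vQ₀ (P.thetaHull (Setting.labelSucc i) vQ₀) = 0 →
        ∃ (s : ℝ) (hs : 0 < s), VolumeDictionary (Model.prototypeDatumPowAt p T s hs) P vQ₀) :=
  ⟨fun _ r hJ D => hullSum_eq_zero_of_volumeDictionary_of_size_le_one D r hJ,
    fun hH => (exists_volumeDictionary_iff_hullSum_eq_zero_real p P vQ₀ hc hq).2 hH⟩

end RealSpec

end Summit.ABC.IUTFork.Joshi

end
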